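/-
Copyright (c) 2026. Released under Apache 2.0 license.
Literature formalization: Chen–Voutier, Lemma 2 (algebraic core).
-/
import Mathlib

/-!
# Binomial identities behind the Padé approximants to `x ^ α` at `x = 1`

[cite: ChenVoutier1997, Lemma 2 and its proof (arXiv:1401.5450, Lemma 2.4)]

J. H. Chen and P. M. Voutier, *Complete solution of the Diophantine equation `X² + 1 = dY⁴` and a
related family of quartic Thue equations*, J. Number Theory **62** (1997), 71–99, Lemma 2:
for positive integers `m, n` and real `α` put
`p_m(X) = ∑_{ν=0}^{m} C(m-α, m-ν) C(n+α, ν) X^ν`, `q_n(X) = ∑_{ν=0}^{n} C(m-α, ν) C(n+α, n-ν) X^ν`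
and `r(x) = x^α q_n(x) - p_m(x)`.  The printed proof rests on the formula
`r^{(k)}(x)/k! = ∑_ν C(m-α,ν) C(n+α,n-ν) C(ν+α,k) x^{α+ν-k} - ∑_ν C(m-α,m-ν) C(n+α,ν) C(ν,k) x^{ν-k}`
and on three identities between (generalised) binomial coefficients:

* `∑_{ν=0}^{n} C(m-α,ν) C(n+α,n-ν) C(ν+α,k) = C(n+α,k) C(m+n-k,n)`
  (via `C(n+α,n-ν) C(ν+α,k) = C(n-k+α,n-ν) C(n+α,k)` and Vandermonde's formula),
* `∑_{ν=k}^{m} C(m-α,m-ν) C(n+α,ν) C(ν,k) = C(n+α,k) C(m+n-k,n)` for `k ≤ m`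
  (via `C(n+α,ν) C(ν,k) = C(n+α,k) C(n-k+α,ν-k)` and Vandermonde's formula),
  so that `r^{(k)}(1) = 0` for `k = 0, …, m` (the Padé property at `x = 1`), and
* `C(m-α,ν) C(n+α,n-ν) C(ν+α,m+1) = (-1)^{ν-m} (α/(m+1)) C(m-α,m) C(n+α,n) C(n,ν)`,
  whence `r^{(m+1)}(x)/(m+1)! = (-1)^m (α/(m+1)) C(m-α,m) C(n+α,n) x^{α-m-1} (1-x)^n`.

We prove these identities here, with `C = Ring.choose` over `ℝ` (Mathlib's binomial-ring
binomial coefficient, which for real `a` is `a (a-1) ⋯ (a-k+1) / k!`,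
see `ring_choose_eq_prod_div`), together with the derivative rule
`(k+1) C(e,k+1) = (e-k) C(e,k)` used in the formula for `r^{(k)}`.  The analytic half of
Lemma 2 (Taylor's formula with integral remainder) is not treated in this file.
-/

open Finset

namespace Literature.NumberTheory.DiophantineApproximation

/-! ### Generalised binomial coefficients over `ℝ` as products -/

/-- For real `a`, `Ring.choose a k = a (a - 1) ⋯ (a - k + 1) / k!` [folklore]. -/
theorem ring_choose_eq_prod_div (a : ℝ) (k : ℕ) :
    Ring.choose a k = (∏ i ∈ range k, (a - i)) / k.factorial := by
  rw [Ring.choose_eq_smul, Polynomial.descPochhammer_smeval_eq_ascPochhammer,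
    Polynomial.ascPochhammer_smeval_eq_eval, ← descPochhammer_eval_eq_ascPochhammer,
    descPochhammer_eval_eq_prod_range, smul_eq_mul, div_eq_inv_mul]

/-- Vandermonde's formula `∑_{ν=0}^{n} C(a,ν) C(b,n-ν) = C(a+b,n)` for real `a, b`
(Mathlib's `Ring.add_choose_eq`, re-indexed over `range (n + 1)`) [folklore]. -/
theorem sum_range_choose_mul_choose (a b : ℝ) (n : ℕ) :
    ∑ ν ∈ range (n + 1), Ring.choose a ν * Ring.choose b (n - ν) = Ring.choose (a + b) n := by
  rw [Ring.add_choose_eq n (Commute.all a b), Finset.Nat.sum_antidiagonal_eq_sum_range_succ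
    (fun i j => Ring.choose a i * Ring.choose b j)]

/-- Splitting a falling product: `∏_{l<i+j} (a-l) = ∏_{l<i} (a-l) ⬝ ∏_{l<j} (a-i-l)`
[folklore]. -/
theorem prod_range_add_sub (a : ℝ) (i j : ℕ) :
    ∏ l ∈ range (i + j), (a - l) = (∏ l ∈ range i, (a - l)) * ∏ l ∈ range j, (a - i - l) := by
  rw [prod_range_add]
  congr 1
  exact prod_congr rfl fun l _ => by push_cast; ring

/-- The derivative rule `(k+1) C(e,k+1) = (e-k) C(e,k)` (so that
`d/dx (C(e,k) x^{e-k}) = (k+1) C(e,k+1) x^{e-k-1}`) [folklore]. -/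
theorem succ_mul_ring_choose_succ (e : ℝ) (k : ℕ) :
    ((k : ℝ) + 1) * Ring.choose e (k + 1) = (e - k) * Ring.choose e k := by
  rw [ring_choose_eq_prod_div, ring_choose_eq_prod_div, prod_range_succ, Nat.factorial_succ]
  have hk : ((k.factorial : ℕ) : ℝ) ≠ 0 := by positivity
  have hk1 : ((k : ℝ) + 1) ≠ 0 := by positivity
  push_cast
  field_simp

/-- `C(ν,k) = 0` for natural `ν < k`, in `Ring.choose` form [folklore]. -/
theorem ring_choose_natCast_of_lt {ν k : ℕ} (h : ν < k) : Ring.choose (ν : ℝ) k = 0 := by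
  rw [Ring.choose_natCast, Nat.choose_eq_zero_of_lt h, Nat.cast_zero]

/-- `C(ν,k)` for natural `ν` is the ordinary binomial coefficient [folklore]. -/
theorem ring_choose_natCast' (ν k : ℕ) : Ring.choose (ν : ℝ) k = (ν.choose k : ℝ) :=
  Ring.choose_natCast ν k

/-- `C(r+α,r) > 0` for `α > -1` [folklore]. -/
theorem ring_choose_add_self_pos {α : ℝ} (hα : -1 < α) (r : ℕ) :
    0 < Ring.choose ((r : ℝ) + α) r := by
  rw [ring_choose_eq_prod_div]
  refine div_pos (prod_pos fun l hl => ?_) (by positivity)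
  have : (l : ℝ) + 1 ≤ r := by exact_mod_cast mem_range.mp hl
  linarith

/-- `C(r-α,r) > 0` for `α < 1` [folklore]. -/
theorem ring_choose_sub_self_pos {α : ℝ} (hα : α < 1) (r : ℕ) :
    0 < Ring.choose ((r : ℝ) - α) r := by
  rw [ring_choose_eq_prod_div]
  refine div_pos (prod_pos fun l hl => ?_) (by positivity)
  have : (l : ℝ) + 1 ≤ r := by exact_mod_cast mem_range.mp hl
  linarith

/-! ### The absorption identity and the first sum -/

/-- `C(n+α,n-ν) C(ν+α,k) = C(n+α-k,n-ν) C(n+α,k)` for `ν ≤ n`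
[cite: ChenVoutier1997, proof of Lemma 2, first display after "Note that"]. -/
theorem choose_mul_choose_absorb (α : ℝ) {n ν : ℕ} (k : ℕ) (hν : ν ≤ n) :
    Ring.choose ((n : ℝ) + α) (n - ν) * Ring.choose ((ν : ℝ) + α) k =
      Ring.choose ((n : ℝ) + α - k) (n - ν) * Ring.choose ((n : ℝ) + α) k := by
  simp only [ring_choose_eq_prod_div]
  rw [div_mul_div_comm, div_mul_div_comm, mul_comm (((n - ν).factorial : ℕ) : ℝ)]
  congr 1
  have h1 := prod_range_add_sub ((n : ℝ) + α) (n - ν) k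
  have h2 := prod_range_add_sub ((n : ℝ) + α) k (n - ν)
  rw [add_comm k, h1] at h2
  have e1 : ∏ l ∈ range k, ((n : ℝ) + α - ↑(n - ν) - l) = ∏ l ∈ range k, ((ν : ℝ) + α - l) :=
    prod_congr rfl fun l _ => by rw [Nat.cast_sub hν]; ring
  rw [← e1, h2, mul_comm]

/-- First identity: `∑_{ν=0}^{n} C(m-α,ν) C(n+α,n-ν) C(ν+α,k) = C(n+α,k) C(m+n-k,n)`
[cite: ChenVoutier1997, proof of Lemma 2]. (Here `C(m+n-k,n)` is `Ring.choose` of the real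
number `m+n-k`; for `k ≤ m+n` it is the ordinary binomial coefficient, `Ring.choose_natCast`.) -/
theorem sum_qcoeff_mul_choose (α : ℝ) (m n k : ℕ) :
    ∑ ν ∈ range (n + 1), Ring.choose ((m : ℝ) - α) ν * Ring.choose ((n : ℝ) + α) (n - ν) *
        Ring.choose ((ν : ℝ) + α) k =
      Ring.choose ((n : ℝ) + α) k * Ring.choose ((m : ℝ) + n - k) n := by
  calc _ = ∑ ν ∈ range (n + 1), Ring.choose ((n : ℝ) + α) k *
        (Ring.choose ((m : ℝ) - α) ν * Ring.choose ((n : ℝ) + α - k) (n - ν)) := by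
          refine sum_congr rfl fun ν hν => ?_
          have hνn : ν ≤ n := Nat.lt_succ_iff.mp (mem_range.mp hν)
          rw [mul_assoc, choose_mul_choose_absorb α k hνn]
          ring
    _ = Ring.choose ((n : ℝ) + α) k * Ring.choose ((m : ℝ) - α + ((n : ℝ) + α - k)) n := by
          rw [← mul_sum, sum_range_choose_mul_choose]
    _ = _ := by congr 2; ring

/-! ### The second sum and the Padé property at `x = 1` -/

/-- Second identity: `∑_{ν=k}^{m} C(m-α,m-ν) C(n+α,ν) C(ν,k) = C(n+α,k) C(m+n-k,n)` for `k ≤ m`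
[cite: ChenVoutier1997, proof of Lemma 2] (the terms with `ν < k` vanish, so we sum over
`0 ≤ ν ≤ m`). -/
theorem sum_pcoeff_mul_choose (α : ℝ) {m k : ℕ} (n : ℕ) (hk : k ≤ m) :
    ∑ ν ∈ range (m + 1), Ring.choose ((m : ℝ) - α) (m - ν) * Ring.choose ((n : ℝ) + α) ν *
        Ring.choose (ν : ℝ) k =
      Ring.choose ((n : ℝ) + α) k * Ring.choose ((m : ℝ) + n - k) n := by
  set f : ℕ → ℝ := fun ν => Ring.choose ((m : ℝ) - α) (m - ν) * Ring.choose ((n : ℝ) + α) ν *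
    Ring.choose (ν : ℝ) k with hf
  rw [← sum_range_add_sum_Ico f (Nat.le_succ_of_le hk), sum_eq_zero (fun ν hν => by
      rw [hf]; dsimp only; rw [ring_choose_natCast_of_lt (mem_range.mp hν), mul_zero]),
    zero_add, sum_Ico_eq_sum_range]
  have hterm : ∀ μ ∈ range (m + 1 - k), f (k + μ) = Ring.choose ((n : ℝ) + α) k *
      (Ring.choose ((n : ℝ) + α - k) μ * Ring.choose ((m : ℝ) - α) (m - k - μ)) := by
    intro μ _
    have h := Ring.choose_smul_choose ((n : ℝ) + α) (Nat.le_add_right k μ)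
    rw [Nat.add_sub_cancel_left, nsmul_eq_mul] at h
    rw [hf]
    dsimp only
    rw [show m - (k + μ) = m - k - μ from (Nat.sub_sub m k μ).symm, ring_choose_natCast']
    calc _ = Ring.choose ((m : ℝ) - α) (m - k - μ) *
          ((((k + μ).choose k : ℕ) : ℝ) * Ring.choose ((n : ℝ) + α) (k + μ)) := by ring
      _ = _ := by rw [h]; ring
  rw [sum_congr rfl hterm, ← mul_sum, show m + 1 - k = (m - k) + 1 by omega,
    sum_range_choose_mul_choose]
  have e1 : (n : ℝ) + α - k + ((m : ℝ) - α) = ((m - k + n : ℕ) : ℝ) := by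
    push_cast [Nat.cast_sub hk]; ring
  have e2 : (m : ℝ) + n - k = ((m - k + n : ℕ) : ℝ) := by
    push_cast [Nat.cast_sub hk]; ring
  rw [e1, e2, Ring.choose_natCast, Ring.choose_natCast, Nat.choose_symm_add]

/-- The Padé property `r^{(k)}(1)/k! = 0` for `k = 0, 1, …, m`
[cite: ChenVoutier1997, proof of Lemma 2, "Hence r^{(k)}(1)/k! = 0"]: the two coefficient sums
agree. -/
theorem sum_qcoeff_mul_choose_eq_sum_pcoeff_mul_choose (α : ℝ) {m k : ℕ} (n : ℕ) (hk : k ≤ m) :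
    ∑ ν ∈ range (n + 1), Ring.choose ((m : ℝ) - α) ν * Ring.choose ((n : ℝ) + α) (n - ν) *
        Ring.choose ((ν : ℝ) + α) k =
      ∑ ν ∈ range (m + 1), Ring.choose ((m : ℝ) - α) (m - ν) * Ring.choose ((n : ℝ) + α) ν *
        Ring.choose (ν : ℝ) k := by
  rw [sum_qcoeff_mul_choose, sum_pcoeff_mul_choose α n hk]

/-! ### The coefficient of order `m + 1` -/

/-- Third identity: for `ν ≤ m` and `ν ≤ n`,
`C(m-α,ν) C(n+α,n-ν) C(ν+α,m+1) = (-1)^{ν+m} (α/(m+1)) C(m-α,m) C(n+α,n) C(n,ν)`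
[cite: ChenVoutier1997, proof of Lemma 2, "Further computation shows"]. -/
theorem qcoeff_mul_choose_succ (α : ℝ) {m n ν : ℕ} (hνm : ν ≤ m) (hνn : ν ≤ n) :
    Ring.choose ((m : ℝ) - α) ν * Ring.choose ((n : ℝ) + α) (n - ν) *
        Ring.choose ((ν : ℝ) + α) (m + 1) =
      (-1) ^ (ν + m) * (α / (m + 1)) * Ring.choose ((m : ℝ) - α) m *
        Ring.choose ((n : ℝ) + α) n * (n.choose ν : ℝ) := by
  -- the four products involved, and their decompositions
  have hA : ∏ l ∈ range m, ((m : ℝ) - α - l) =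
      (∏ l ∈ range ν, ((m : ℝ) - α - l)) * ∏ l ∈ range (m - ν), ((m : ℝ) - ν - α - l) := by
    have := prod_range_add_sub ((m : ℝ) - α) ν (m - ν)
    rw [Nat.add_sub_cancel' hνm] at this
    rw [this]
    congr 1
    exact prod_congr rfl fun l _ => by ring
  have hB : ∏ l ∈ range n, ((n : ℝ) + α - l) =
      (∏ l ∈ range (n - ν), ((n : ℝ) + α - l)) * ∏ l ∈ range ν, ((ν : ℝ) + α - l) := by
    have := prod_range_add_sub ((n : ℝ) + α) (n - ν) ν
    rw [Nat.sub_add_cancel hνn] at this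
    rw [this]
    congr 1
    exact prod_congr rfl fun l _ => by rw [Nat.cast_sub hνn]; ring
  have hC : ∏ l ∈ range (m + 1), ((ν : ℝ) + α - l) =
      (∏ l ∈ range ν, ((ν : ℝ) + α - l)) * (α * ∏ l ∈ range (m - ν), (α - 1 - l)) := by
    have := prod_range_add_sub ((ν : ℝ) + α) ν (m - ν + 1)
    rw [show ν + (m - ν + 1) = m + 1 by omega] at this
    rw [this]
    congr 1
    rw [prod_range_succ', mul_comm]
    congr 1
    · push_cast; ring
    · exact prod_congr rfl fun l _ => by push_cast; ring
  have hD : ∏ l ∈ range (m - ν), ((m : ℝ) - ν - α - l) =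
      (-1) ^ (m - ν) * ∏ l ∈ range (m - ν), (α - 1 - l) := by
    rw [← prod_range_reflect (fun l => (α - 1 - (l : ℝ))) (m - ν)]
    have : ((-1 : ℝ)) ^ (m - ν) = ∏ _l ∈ range (m - ν), (-1 : ℝ) := by
      rw [prod_const, card_range]
    rw [this, ← prod_mul_distrib]
    refine prod_congr rfl fun j hj => ?_
    have hj' : j < m - ν := mem_range.mp hj
    rw [Nat.cast_sub (by omega : j ≤ m - ν - 1), Nat.cast_sub (by omega : 1 ≤ m - ν),
      Nat.cast_sub hνm]
    push_cast
    ring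
  have hD' : ∏ l ∈ range (m - ν), (α - 1 - (l : ℝ)) =
      (-1) ^ (m - ν) * ∏ l ∈ range (m - ν), ((m : ℝ) - ν - α - l) := by
    rw [hD, ← mul_assoc, ← pow_add, ← two_mul, pow_mul]
    norm_num
  have hsign : ((-1 : ℝ)) ^ (ν + m) = (-1) ^ (m - ν) := by
    rw [show ν + m = (m - ν) + 2 * ν by omega, pow_add, pow_mul]
    norm_num
  have hf1 : (((m + 1).factorial : ℕ) : ℝ) = ((m : ℝ) + 1) * m.factorial := by
    rw [Nat.factorial_succ]; push_cast; ring
  have hf2 : (n.choose ν : ℝ) = n.factorial / (ν.factorial * (n - ν).factorial) := by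
    rw [Nat.choose_eq_factorial_div_factorial hνn,
      Nat.cast_div (Nat.factorial_mul_factorial_dvd_factorial hνn) (by positivity)]
    push_cast
    ring
  simp only [ring_choose_eq_prod_div]
  rw [hA, hB, hC, hD', hsign, hf1, hf2]
  have h1 : ((m.factorial : ℕ) : ℝ) ≠ 0 := by positivity
  have h2 : ((n.factorial : ℕ) : ℝ) ≠ 0 := by positivity
  have h3 : ((ν.factorial : ℕ) : ℝ) ≠ 0 := by positivity
  have h4 : (((n - ν).factorial : ℕ) : ℝ) ≠ 0 := by positivity
  have h5 : ((m : ℝ) + 1) ≠ 0 := by positivity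
  field_simp

/-- Summed form of the third identity: for `n ≤ m` and any complex `x`,
`∑_{ν=0}^{n} C(m-α,ν) C(n+α,n-ν) C(ν+α,m+1) x^ν = (-1)^m (α/(m+1)) C(m-α,m) C(n+α,n) (1-x)^n`,
i.e. `r^{(m+1)}(x)/(m+1)! = (-1)^m (α/(m+1)) C(m-α,m) C(n+α,n) x^{α-m-1} (1-x)^n`
[cite: ChenVoutier1997, proof of Lemma 2, display beginning `r^{(m+1)}(x)/(m+1)!`]. -/
theorem sum_qcoeff_mul_choose_succ_mul_pow (α : ℝ) {m n : ℕ} (hnm : n ≤ m) (x : ℂ) :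
    ∑ ν ∈ range (n + 1), ((Ring.choose ((m : ℝ) - α) ν * Ring.choose ((n : ℝ) + α) (n - ν) *
        Ring.choose ((ν : ℝ) + α) (m + 1) : ℝ) : ℂ) * x ^ ν =
      (((-1) ^ m * (α / (m + 1)) * Ring.choose ((m : ℝ) - α) m * Ring.choose ((n : ℝ) + α) n :
        ℝ) : ℂ) * (1 - x) ^ n := by
  have hterm : ∀ ν ∈ range (n + 1), ((Ring.choose ((m : ℝ) - α) ν *
      Ring.choose ((n : ℝ) + α) (n - ν) * Ring.choose ((ν : ℝ) + α) (m + 1) : ℝ) : ℂ) * x ^ ν =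
      (((-1) ^ m * (α / (m + 1)) * Ring.choose ((m : ℝ) - α) m * Ring.choose ((n : ℝ) + α) n :
        ℝ) : ℂ) * ((-x) ^ ν * 1 ^ (n - ν) * (n.choose ν : ℂ)) := by
    intro ν hν
    have hνn : ν ≤ n := Nat.lt_succ_iff.mp (mem_range.mp hν)
    rw [qcoeff_mul_choose_succ α (hνn.trans hnm) hνn, pow_add, neg_pow x ν]
    push_cast
    ring
  rw [sum_congr rfl hterm, ← mul_sum, ← add_pow, neg_add_eq_sub]

end Literature.NumberTheory.DiophantineApproximation
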